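import Summits.QuantumFields.BalabanUV.T4Continuum.Support.NE9Lemma1CurveSpeciesEnd
import Summits.QuantumFields.BalabanUV.T4Continuum.Support.NE9Lemma1CurveSpeciesAdditive

/-!
# NE9Lemma1CurveSpeciesEndAdditive — crew row (w21)-END-REM-S3: the row owner's `…_compProj` END face AT THE CURVE SPECIES
# (`NE9Lemma1CurveSpeciesEnd.termSize_ne9_and_fadingMemory_cur_compProj`, t4-ne9-p1-g25 part 3, p214041) WITH ITS S3 BINDER
# DISCHARGED BY NAME by crew row (w19) (`NE9Lemma1CurveSpeciesAdditive.pieceAdditiveOn_cur`, author leaf-08-g4, p215330) — the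
# CURVE twin of leaf-08-g4's «END-REM-S3» `NE9Lemma1RemainderSpeciesEndAdditive` (p213470, ray = abelian sub-case); cell
# `pub-balaban`, T4-DAG §2 node U3 / §6 NE9; rung (B)+1 on a FIXED finite T⁴; NE9 formalisation swarm, unit
# `b2b-balaban-t4-ne9-formalise-leaf-01` gen 7 (crew row (w21)-END-S3 of the owner's l.9603 — natural owner lineage leaf-08,
# taken by guarded claim with no leaf-08 seat online after (w19) landed by courier); nothing of any import is modified

HONEST FRAMING (T4-DAG PAGE 1).  Rung (B)+1 = existence and uniqueness of the ε → 0 limit of gauge-invariant observables on a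
FIXED finite torus T⁴ — NOT infinite volume, NOT a mass gap, NOT the Clay problem.  NE9 (`T4OutputRate.NE9` ∧ `FadingMemory`) is
a cell NEW ESTIMATE, NOT PRINTED and NOT discharged here («NE9 ⇐ the named binders»); spine 0/9.  HONEST DEPENDENCY (cell line,
verbatim): continuum YM on T⁴ ⇐ BetaPertH ∧ nine spine estimates (0/9 proved); BetaPertH ⇐ (D1) ∧ (D4) ∧ CAP+tail; G-an2-4 gates
asym, D1 and NE2/3/4.  `FlowStep.BetaPertH`, (B), (B^μ) do not occur.  [I] = [Balaban1987RG1] (CMP **109**), [II] =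
[Balaban1988RG2Cluster] (CMP **116**) are quoted for TYPES only (ABSOLUTE RULE: nothing printed in the audited series is asserted).

WHAT THIS FILE IS.  The owner's part 3 (p214041) is the skeleton's END on the corrected dictionary
(`NE9MarginalProjectionEnd.…_vacSub_sizeInduction_compProj`) at `𝒯 := cpieceChannel D.toC` for a CURVE datum `D : CurData`
(the (1.23)-pieces of the fifth-order remainder of [I] (3.34) taken ALONG THE ANALYTIC SLICE CURVES of Lemma 4 (3.53) p. 280 —
located correction O-ne9p1g25-1), with S4/S5 discharged by name and S3 DISPLAYED as `hA : PieceAdditiveOn (analyticClass D.R)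
D.toC`.  Crew row (w19) (leaf-08-g4) PROVED that binder from `0 < κ₁`, `0 < r_k`, `1 < ϱ` and the two SLICE-CURVE REGULARITY
binders: `hcurA` — every slice curve is analytic on its disc `|σ′| < ϱ` and maps it into the analyticity ball of its source (TYPE
[I] Lemma 4 (3.53); the `Admissible.cur_an` clause asked everywhere, a harmless convention); `hcurC` — the curve family is jointly
continuous in `(t, s, σ, σ′)` on the unit slice circle (TYPE [II] (1.21)/(1.23) p. 7).  THIS FILE substitutes that proof:
**`termSize_ne9_and_fadingMemory_cur_compProj_add`** — p214041's face TOKEN FOR TOKEN with `hA ↦ pieceAdditiveOn_cur D _ hD.r_pos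
hD.ϱ_gt hcurA hcurC` (`0 < κ₁` from `CurData.Admissible.κ₁_ge`); `hcurA`/`hcurC` displayed in `hA`'s place; everything else
VERBATIM; conclusion LITERALLY the face's, `ω′ = ω + 8·lipbar·B·((1 + c)·c_Q)`.  After it the `…_compProj` END at the curve
species displays NO abstract S-binder: `CurData.Admissible` (Lemma 4 (3.53) TYPE + gain ϱ⁻¹ ≤ c_dir·ℓ + radii + G1), the level
counts (1.26)–(1.28), the curve regularity `hcurA`/`hcurC`, `MF ⊆ analyticClass D.R`, and the face's own A1/A2/A3/RO-type binders
and scalars — O1 («Bałaban's (1.23)-pieces ARE `CurData.toC` of his data») as always.  §2 records, by `rfl` transport along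
`RemData.toCur_toC`, that leaf-08-g4's ray face `NE9Lemma1RemainderSpeciesEndAdditive` is NOT superseded: the ray datum's
direction-regularity binders are a different (abelian sub-case) reading; nothing landed is touched.
DISGUISE TEST: unchanged from the face (skeleton §5 (g2)) — one END-level composition BY NAME; not NE9.

References (TYPES only): [Balaban1987RG1] T. Bałaban, CMP **109** (1987) 249–301, (3.34) p. 277, Lemma 4 (3.53)–(3.54) p. 280;
[Balaban1988RG2Cluster] T. Bałaban, CMP **116** (1988) 1–22, (1.21)–(1.29) pp. 7–8, (1.36) p. 9.  Summits-side NEW work (LEAN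
PLACEMENT RULE); imports the owner's `NE9Lemma1CurveSpeciesEnd` (p214041) and (w19) `NE9Lemma1CurveSpeciesAdditive` (p215330)
ONLY; modifies nothing; 0 `def`, 0 sorry.  Value = bookkeeping: one displayed binder of the curve-species END replaced by its
kernel discharger's displayed inputs, NOT summit progress.
-/

noncomputable section

namespace Summit.QuantumFields.BalabanUV.T4Continuum.NE9Lemma1CurveSpeciesEndAdditive

open scoped BigOperators
open Metric Set
open Literature.Probability.LatticeModels
open Literature.MathematicalPhysics.QuantumFieldTheory.Balaban1983to89
open Literature.MathematicalPhysics.QuantumFieldTheory.Balaban1983to89.T4OutputRate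
open Literature.MathematicalPhysics.QuantumFieldTheory.Balaban1983to89.T4HistoryLipschitzRecursion
open Literature.MathematicalPhysics.QuantumFieldTheory.Balaban1983to89.T4HistoryLipschitzOuter
open Literature.MathematicalPhysics.QuantumFieldTheory.Balaban1983to89.T4HistoryLipschitzActivity
open Literature.MathematicalPhysics.QuantumFieldTheory.Balaban1983to89.T4HistoryLipschitzActivity (ClusterGeom)
open Literature.MathematicalPhysics.QuantumFieldTheory.Balaban1983to89.T4HistoryLipschitzSegment
open Summit.QuantumFields.BalabanUV.T4Continuum.NE9Lemma1Counting
open Summit.QuantumFields.BalabanUV.T4Continuum.NE9Lemma1Gain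
open Summit.QuantumFields.BalabanUV.T4Continuum.NE9Lemma1PieceClass
open Summit.QuantumFields.BalabanUV.T4Continuum.NE9Lemma1RemainderSpecies
open Summit.QuantumFields.BalabanUV.T4Continuum.NE9Lemma1CurveSpecies
open Summit.QuantumFields.BalabanUV.T4Continuum.NE9Lemma1CurveSpeciesAdditive (pieceAdditiveOn_cur)
open Summit.QuantumFields.BalabanUV.T4Continuum.NE9Lemma1CurveSpeciesEnd
open Summit.QuantumFields.BalabanUV.T4Continuum.NE9ComplexEncoding (doubleCarriers)
open Summit.QuantumFields.BalabanUV.T4Continuum.NE9MarginalProjection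
open Summit.QuantumFields.BalabanUV.T4Continuum.NE9MarginalProjectionEnd

/-! ## §1 The curve-species END face with S3 discharged — crew row (w21)-END-REM-S3 -/

section End

variable {C₀ : Carriers} {E : Type} [NormedAddCommGroup E] [NormedSpace ℂ E] {ι α β γ δ : Type} [DecidableEq δ]

/-- **THE NE9 END (`…_compProj` face) AT THE CURVE SPECIES WITH ITS S3 BINDER DISCHARGED** (crew row (w21)-END-REM-S3).
The owner's `NE9Lemma1CurveSpeciesEnd.termSize_ne9_and_fadingMemory_cur_compProj` (p214041) token for token, except that the
displayed `hA : PieceAdditiveOn (analyticClass D.R) D.toC` is PRODUCED inside by crew row (w19)'s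
`NE9Lemma1CurveSpeciesAdditive.pieceAdditiveOn_cur` (leaf-08-g4) from `CurData.Admissible` (`1 ≤ κ₁`, `0 < r_k`, `1 < ϱ`) and the
two SLICE-CURVE REGULARITY binders displayed here in its place — **`hcurA`** (every slice curve analytic on its disc `|σ′| < ϱ`
and mapping it into the analyticity ball of its source; TYPE [I] Lemma 4 (3.53) p. 280) and **`hcurC`** (the curve family jointly
continuous in `(t, s, σ, σ′)` on the unit slice circle; TYPE [II] (1.21)/(1.23) p. 7).  `hD hℓg hL hO1 hcQ hMF` and ALL the
face's own binders VERBATIM; conclusion LITERALLY the face's with `ω′ = ω + 8·lipbar·B·((1 + c)·c_Q)`.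
[cite: Balaban1987RG1, (3.34) p.277, (3.53)-(3.54) p.280; Balaban1988RG2Cluster, (1.21)-(1.29) pp.7-8, (1.36) p.9] -/
theorem termSize_ne9_and_fadingMemory_cur_compProj_add (G : ClusterGeom (doubleCarriers C₀)) {Pot : Type*}
    [NormedAddCommGroup Pot] [NormedSpace ℂ Pot] {D : CurData C₀ E ι α β γ δ} {ℓg : ℕ → ℕ → ℝ} {cdir d0 O1 cQ : ℝ}
    {Ef : Functional (doubleCarriers C₀) E} {W : Set (ℕ → ℝ)}
    {Adm MF : Set (E → (doubleCarriers C₀).Dom → ℝ)}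
    {P : (E → (doubleCarriers C₀).Dom → ℝ) → (E → (doubleCarriers C₀).Dom → ℝ)}
    {Ψ : ℕ → ℝ → (ι → ℝ) → E → (doubleCarriers C₀).Dom → ℝ} {act : ℕ → ℝ → E → Pot → G.P → ℂ} {𝒜 : ℕ → Set Pot}
    {n : ℕ → ℝ → E → G.P → ℝ} {lip clip : ℕ → ℝ} {a d : G.P → ℝ} {δv : (doubleCarriers C₀).Dom → ℝ}
    {κ B lipbar clipbar qTbar ω c : ℝ} {qT p₀ N : ℕ → ℝ}
    -- the species' binders (printed TYPE + numerals) and the class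
    (hD : D.Admissible ℓg cdir d0) (hℓg : ∀ k j, 0 ≤ ℓg k j)
    (hL : LevelCountsG D.toC.frame κ D.κ₁ O1 cQ (fun k j => ℓg k j ^ 5) (agePow ω)) (hO1 : 0 ≤ O1) (hcQ : 0 ≤ cQ)
    (hMF : MF ⊆ analyticClass D.R)
    -- (w19)'s displayed inputs IN PLACE OF `hA`: slice-curve regularity
    (hcurA : ∀ k s y a b x t s' σ', DifferentiableOn ℂ (D.cur k s y a b x t s' σ') (ball 0 (D.ϱ k s y a b x)) ∧
      MapsTo (D.cur k s y a b x t s' σ') (ball 0 (D.ϱ k s y a b x)) (ball 0 (D.R x.1)))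
    (hcurC : ∀ k s y a b x, ContinuousOn
      (fun q : (ℂ × (δ → ℝ) × (δ → ℂ)) × ℂ => D.cur k s y a b x q.1.1 q.1.2.1 q.1.2.2 q.2) (univ ×ˢ sphere (0:ℂ) 1))
    -- the face's binders, verbatim
    (ρ : ℕ → (ι → ℝ) → Pot) (U₀ : E) (explZ : ℕ → E → (doubleCarriers C₀).Dom → ℝ) (h0 : ScaleZeroFree Ef W)
    (hAdm : AdmissibleTerms Ef W Adm) (hres : AdmRestrict Adm)
    (hPadd : ProjAdditive Adm P) (hPcomm : ProjScaleComm Adm P) (hPinto : ProjInto Adm MF P) (hPsize : ProjSize Adm P κ c)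
    (hc : 0 ≤ c)
    (hfac : Factorises Ef W (compProj (cpieceChannel D.toC) P) Ψ) (hclip0 : ∀ k, 0 ≤ clip k)
    (hCup : ∀ g ∈ W, ∀ g' ∈ W, ∀ (k : ℕ) (U : E) (X : (doubleCarriers C₀).Dom), (doubleCarriers C₀).scale X = k + 1 →
      ∀ Q ∈ 𝒜 k, ∀ γ' ∈ G.vol X,
      ‖act k (g k) U Q γ'‖ ≤ n k (g' k) U γ' ∧
        ‖act k (g k) U Q γ' - act k (g' k) U Q γ'‖ ≤ clip k * |g k - g' k| * n k (g' k) U γ')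
    (hqT0 : ∀ k, 0 ≤ qT k)
    (hTcup : ∀ g ∈ W, ∀ g' ∈ W, ∀ (k : ℕ) (y : ι),
      |compProj (cpieceChannel D.toC) P k g (Ef g) y - compProj (cpieceChannel D.toC) P k g' (Ef g) y| ≤
        weightOf D.toC.frame D.κ₁ d0 O1 (D.Kp cdir) k y * (qT k * |g k - g' k|))
    (hreprV : ∀ (k : ℕ) (s : ℝ) (Q : ι → ℝ) (U : E) (X : (doubleCarriers C₀).Dom),
      Ψ k s Q U X = (G.newTerm act k s U X (ρ k Q)).re - (G.newTerm act k s U₀ X (ρ k Q)).re + explZ k U X)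
    (hclipb : ∀ k, clip k ≤ clipbar) (hqTb : ∀ k, qT k ≤ qTbar)
    (hK : TwoPointKP G W act 𝒜 n lip a d) (hdec : G.DecayExtract δv d) (hpin : G.PinBudget a δv (fun _ => B) κ)
    (hρ : ∀ (k : ℕ) (Q Q' : ι → ℝ) (M : ℝ),
      (∀ y, |Q y - Q' y| ≤ weightOf D.toC.frame D.κ₁ d0 O1 (D.Kp cdir) k y * M) → ‖ρ k Q - ρ k Q'‖ ≤ M)
    (hexplZ : ∀ (k : ℕ) (U : E) (X : (doubleCarriers C₀).Dom), (doubleCarriers C₀).scale X = k + 1 →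
      |explZ k U X| ≤ Real.exp (-(κ * (doubleCarriers C₀).d X)) * p₀ k)
    (hbase : ∀ g ∈ W, ∀ (U : E) (X : (doubleCarriers C₀).Dom), (doubleCarriers C₀).scale X = 0 →
      |Ef g U X| ≤ Real.exp (-(κ * (doubleCarriers C₀).d X)) * N 0)
    (hNsucc : ∀ j, p₀ j + 2 * B ≤ N (j + 1)) (hNnn : ∀ j, 0 ≤ N j)
    (hbox : ∀ (k : ℕ) (Q : ι → ℝ), (∀ y, |Q y| ≤ weightOf D.toC.frame D.κ₁ d0 O1 (D.Kp cdir) k y *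
      sizeRadius (fun k j => (1 + c) * tauOfG cQ (agePow ω) k j) N k) → ρ k Q ∈ 𝒜 k)
    (hB : 0 ≤ B) (hlipb : ∀ k, lip k ≤ lipbar) (hω : 0 ≤ ω)
    (hpos : 0 < ω + 8 * lipbar * B * ((1 + c) * cQ)) :
    TermSize Ef W κ N ∧
      NE9 Ef W κ (prodModuli (8 * clipbar * B + 8 * lipbar * B * qTbar)
        fun _ => ω + 8 * lipbar * B * ((1 + c) * cQ)) ∧
        FadingMemory ((8 * clipbar * B + 8 * lipbar * B * qTbar) / (ω + 8 * lipbar * B * ((1 + c) * cQ)))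
          (ω + 8 * lipbar * B * ((1 + c) * cQ))
          (prodModuli (8 * clipbar * B + 8 * lipbar * B * qTbar) fun _ => ω + 8 * lipbar * B * ((1 + c) * cQ)) :=
  -- the species' S3 binder PRODUCED by (w19) from `CurData.Admissible` (κ₁ ≥ 1, r_k > 0, ϱ > 1) and `hcurA`/`hcurC`
  have hA : PieceAdditiveOn (analyticClass D.R) D.toC :=
    pieceAdditiveOn_cur D (lt_of_lt_of_le one_pos hD.κ₁_ge) hD.r_pos hD.ϱ_gt hcurA hcurC
  termSize_ne9_and_fadingMemory_cur_compProj G hD hℓg hL hO1 hcQ hMF hA ρ U₀ explZ h0 hAdm hres hPadd hPcomm hPinto hPsize hc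
    hfac hclip0 hCup hqT0 hTcup hreprV hclipb hqTb hK hdec hpin hρ hexplZ hbase hNsucc hNnn hbox hB hlipb hω hpos

end End

/-! ## §2 The ray reading (consistency, by `rfl` transport — nothing of leaf-08-g4's ray face is superseded) -/

section RayCase

variable {C₀ : Carriers} {E : Type} [NormedAddCommGroup E] [NormedSpace ℂ E] {ι α β γ δ : Type} [DecidableEq δ]

/-- At the ray reading `Dd.toCur` of a ray datum the slice curves ARE the rays `τ ↦ τ • dir` (`RemData.toCur`, by `rfl`), so the
curve-regularity binder `hcurA` there is the statement that each ray is analytic on its disc and stays in the analyticity ball —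
recorded as the `rfl` identity of the two channels, the only species-specific input of §1; leaf-08-g4's ray face
`NE9Lemma1RemainderSpeciesEndAdditive` (p213470) keeps its own (direction-regularity) binders. [folklore] -/
example (Dd : RemData C₀ E ι α β γ δ) : cpieceChannel Dd.toCur.toC = cpieceChannel Dd.toC := by
  rw [Dd.toCur_toC]

end RayCase

end Summit.QuantumFields.BalabanUV.T4Continuum.NE9Lemma1CurveSpeciesEndAdditive

end
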